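import Literature.AlgebraicGeometry.Motives.HodgeThetaSubalgebraSymplecticRankFourteenSkew
import Literature.AlgebraicGeometry.Motives.HodgeThetaSubalgebraSymplecticRankSixHodge
import HarnessLib

/-!
# The Θ-subalgebra theorem in rank FOURTEEN: rational descent and Theorem L-Sp (invariance of rational tensors)
# (Moonen–Zarhin 1999 Thm. (2.7) for simple abelian sevenfolds with `End⁰ = ℚ`)

Topic `Literature/AlgebraicGeometry/Motives` (namespace `Literature.AlgebraicGeometry.Motives.HodgeStructure`).  Theorems only
(no definition, no named fact; D-0026).  VERBATIM rank-fourteen twin of §2–§3 of `HodgeThetaSubalgebraSymplecticRankSixHodge` and of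
`HodgeThetaSubalgebraSymplecticRankTenHodge` (`10 ↦ 14`), on top of `SymplecticThetaFourteen.mem_spanC_of_skew`
(`HodgeThetaSubalgebraSymplecticRankFourteenSkew`), written for the cell `pub-hodge-ring2` (literature lane gen 83, programme R63; honest framing of that cell: research route conditional on
HC_CM; not a corollary; Q11.4-sentence-2 already refuted in dim ≥ 3 — this file is unconditional): `SymplecticThetaFourteen.mem_iff_skew`,
`mem_hodgeLie_iff_skew` (`Lie Hg = 𝔰𝔭₁₄`), `eq_hodgeLie` (Deligne minimality), and `wordDerAt_eq_zero_of_skew` (Theorem L-Sp: a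
rational coefficient tensor killed by `Θ` is killed by every `ψ_ℂ`-skew operator) — the input of the `AVSlots` assembly
(`GenericAbelianSevenfoldPowersHodgeClasses`).

## References

* [MoonenZarhin1999LowDim] B. Moonen, Yu. Zarhin, Math. Ann. 315 (1999), §2 (2.3), p. 715, §1 (1.8), §3 (3.1).
* [Deligne1982HodgeCycles] P. Deligne, Hodge cycles on abelian varieties, LNM 900 (1982), I §3 Prop. 3.4.
* [Milne1999LefschetzClasses] J. S. Milne, Lefschetz classes on abelian varieties, Duke Math. J. 96 (1999), Prop. 3.6 (a).
* [Huybrechts2016K3] D. Huybrechts, Lectures on K3 surfaces (2016), Thm. 3.3.9.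
-/

open scoped TensorProduct

namespace Literature.AlgebraicGeometry.Motives

namespace HodgeStructure

universe u

variable {V : Type u} [AddCommGroup V] [Module ℚ V] {n : ℤ}

/-- **`𝔤 = 𝔰𝔭(V, ψ)` over `ℚ`** (rank fourteen; descent `X ∈ 𝔤 ↔ X_ℂ ∈ 𝔤_ℂ`).
[cite: MoonenZarhin1999LowDim, §2 (2.3)]; [cite: Deligne1982HodgeCycles, I §3 (proof of Prop. 3.4)] -/
theorem SymplecticThetaFourteen.mem_iff_skew [Module.Finite ℚ V] [HodgeTensorFacts.{u, u}] (H : HodgeStructure V n) (hn : n = 1)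
    (heff : H.IsEffective) (ψ : H.Polarization) (hE : ∀ a ∈ H.endAlg, ∃ x : ℚ, a = x • (1 : Module.End ℚ V))
    (hV : Module.finrank ℚ V = 14) (𝔤 : Submodule ℚ (Module.End ℚ V))
    (hbr : ∀ X ∈ 𝔤, ∀ X' ∈ 𝔤, X * X' - X' * X ∈ 𝔤) {Θ : Module.End ℂ (ℂ ⊗[ℚ] V)}
    (hΘ : ∀ p, ∀ x ∈ H.piece p (n - p), Θ x = ((2 * p - n : ℤ) : ℂ) • x) (hΘ𝔤 : Θ ∈ spanC 𝔤)
    (hskew : ∀ X ∈ 𝔤, ∀ v w, ψ.form (X v) w + ψ.form v (X w) = 0) (X : Module.End ℚ V) :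
    X ∈ 𝔤 ↔ ∀ v w, ψ.form (X v) w + ψ.form v (X w) = 0 := by
  refine ⟨hskew X, fun hX => ?_⟩
  exact mem_of_baseChange_mem_spanC 𝔤 (SymplecticThetaFourteen.mem_spanC_of_skew H hn heff ψ hE hV 𝔤 hbr hΘ hΘ𝔤
    hskew (ThetaSubalgebra.formBaseChange_add_eq_zero_of_skew ψ hX))

/-- **`Lie Hg(H) = 𝔰𝔭(V, ψ)` (Moonen–Zarhin 1999 (2.3), Type I(1), `g = 7`, Thm. (2.7): "`Hg(X) = Sp_D(V,φ)`",
infinitesimally):** for an effective polarized weight-one `H` with `dim V = 14` and `End_Hdg(V) = ℚ`, a rational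
operator lies in the Lie algebra of the Hodge group iff it is `ψ`-skew. `Lie Hg(H)` is admissible:
bracket-closed (`commutator_mem_hodgeLie`), `Θ ∈ Lie Hg ⊗ ℂ` (`mem_hodgeLieC_of_forall_piece`), `ψ`-skew
(`form_apply_add_eq_zero_of_mem_hodgeLie`). [cite: MoonenZarhin1999LowDim, §2 (2.3) and (1.8)]
[cite: Huybrechts2016K3, Thm. 3.3.9 (proof, p. 67)] -/
theorem SymplecticThetaFourteen.mem_hodgeLie_iff_skew [Module.Finite ℚ V] [HodgeTensorFacts.{u, u}] (H : HodgeStructure V n)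
    (hn : n = 1) (heff : H.IsEffective) (ψ : H.Polarization) (hE : ∀ a ∈ H.endAlg, ∃ x : ℚ, a = x • (1 : Module.End ℚ V))
    (hV : Module.finrank ℚ V = 14) (X : Module.End ℚ V) :
    X ∈ H.hodgeLie ↔ ∀ v w, ψ.form (X v) w + ψ.form v (X w) = 0 := by
  obtain ⟨Θ, hΘ⟩ := exists_hodgeTheta H
  have hΘ𝔤 : Θ ∈ spanC H.hodgeLie := (hodgeLieC_eq_spanC H) ▸ H.mem_hodgeLieC_of_forall_piece hΘ
  exact SymplecticThetaFourteen.mem_iff_skew H hn heff ψ hE hV H.hodgeLie (fun X hX Y hY => H.commutator_mem_hodgeLie hX hY)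
    hΘ hΘ𝔤 (fun X hX => form_apply_add_eq_zero_of_mem_hodgeLie ψ hX) X

/-- **`𝔤 = Lie Hg(H)`: `Lie Hg(H)` is the only rational Lie subalgebra of `𝔰𝔭(V, ψ)` whose complexification
contains `Θ`** (Deligne's minimality, LNM 900 I Prop. 3.4, in Lie form, for the generic rank-ten case).
[cite: Deligne1982HodgeCycles, I §3 Prop. 3.4] [cite: MoonenZarhin1999LowDim, §2 (2.3)] -/
theorem SymplecticThetaFourteen.eq_hodgeLie [Module.Finite ℚ V] [HodgeTensorFacts.{u, u}] (H : HodgeStructure V n)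
    (hn : n = 1) (heff : H.IsEffective) (ψ : H.Polarization) (hE : ∀ a ∈ H.endAlg, ∃ x : ℚ, a = x • (1 : Module.End ℚ V))
    (hV : Module.finrank ℚ V = 14) (𝔤 : Submodule ℚ (Module.End ℚ V))
    (hbr : ∀ X ∈ 𝔤, ∀ X' ∈ 𝔤, X * X' - X' * X ∈ 𝔤) {Θ : Module.End ℂ (ℂ ⊗[ℚ] V)}
    (hΘ : ∀ p, ∀ x ∈ H.piece p (n - p), Θ x = ((2 * p - n : ℤ) : ℂ) • x) (hΘ𝔤 : Θ ∈ spanC 𝔤)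
    (hskew : ∀ X ∈ 𝔤, ∀ v w, ψ.form (X v) w + ψ.form v (X w) = 0) : 𝔤 = H.hodgeLie := by
  ext X
  rw [SymplecticThetaFourteen.mem_iff_skew H hn heff ψ hE hV 𝔤 hbr hΘ hΘ𝔤 hskew,
    SymplecticThetaFourteen.mem_hodgeLie_iff_skew H hn heff ψ hE hV]

/-! ## §3 Theorem L-Sp in rank ten: rational tensors killed by `Θ` are killed by `𝔰𝔭(V_ℂ, ψ_ℂ)` -/

section AnnLie

open Literature.RepresentationTheory.GeneralLinear Literature.NumberTheory.DiophantineGeometry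

variable {M N k : ℕ}

/-- **Theorem L-Sp (invariance of rational tensors under `𝔰𝔭(V_ℂ, ψ_ℂ)`; the Lie step of `B(Xⁿ) = D(Xⁿ)` for a
generic abelian SEVENFOLD).** In the setting of `SymplecticThetaFourteen.mem_spanC_of_skew`, let `q` be a rational
coefficient tensor (letters: slots `Fin k` × a `ℚ`-basis `eQ` of `V`) killed — slice by slice, diagonally — by
the matrix of the Hodge operator `Θ`. Then `q` is killed by the matrix of EVERY `ψ_ℂ`-skew operator `Y` of
`V_ℂ`. Proof: the rational Lie algebra `𝔞 ⊆ 𝔰𝔭(V, ψ)` of operators killing `q` (`annLie`, with `End_Hdg(V)` as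
commuting family) is bracket-closed and `Θ ∈ 𝔞_ℂ` by descent (`mem_spanC_annLie`, Deligne LNM 900 I §3), so
`𝔞_ℂ = 𝔰𝔭(V_ℂ, ψ_ℂ) ∋ Y` by the theorem, and `𝔞_ℂ` kills `q_ℂ`. (MZ99 p. 715: "`Hg(X) = Sp_D(V,φ)` […] it
follows that `B(Xⁿ) = D(Xⁿ)` for all `n`"; the passage to divisor classes is by the invariant theory of `Sp`,
Milne 1999 Prop. 3.6 (a).) [cite: MoonenZarhin1999LowDim, §2 p. 715 and (2.3), §1 (1.8)]
[cite: Deligne1982HodgeCycles, I §3 (proof of Prop. 3.4)] [cite: Milne1999LefschetzClasses, Prop. 3.6 (a)] -/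
theorem SymplecticThetaFourteen.wordDerAt_eq_zero_of_skew [Module.Finite ℚ V] [HodgeTensorFacts.{u, u}]
    (H : HodgeStructure V n) (hn : n = 1) (heff : H.IsEffective) (ψ : H.Polarization)
    (hE : ∀ a ∈ H.endAlg, ∃ x : ℚ, a = x • (1 : Module.End ℚ V)) (hV : Module.finrank ℚ V = 14)
    (eQ : Module.Basis (Fin M) ℚ V) (q : (Fin N → Fin k × Fin M) → ℚ) {Θ : Module.End ℂ (ℂ ⊗[ℚ] V)}
    (hΘ : ∀ p, ∀ x ∈ H.piece p (n - p), Θ x = ((2 * p - n : ℤ) : ℂ) • x)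
    (hΘq : ∀ u : Fin N → Fin k, wordDerAt ℂ (fun _ : Fin N =>
      LinearMap.toMatrix (Algebra.TensorProduct.basis ℂ eQ) (Algebra.TensorProduct.basis ℂ eQ) Θ)
      (wordSlice (fun w => algebraMap ℚ ℂ (q w)) u) = 0)
    {Y : Module.End ℂ (ℂ ⊗[ℚ] V)}
    (hYskew : ∀ x y, ψ.form.baseChange ℂ (Y x) y + ψ.form.baseChange ℂ x (Y y) = 0) (u : Fin N → Fin k) :
    wordDerAt ℂ (fun _ : Fin N =>
      LinearMap.toMatrix (Algebra.TensorProduct.basis ℂ eQ) (Algebra.TensorProduct.basis ℂ eQ) Y)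
      (wordSlice (fun w => algebraMap ℚ ℂ (q w)) u) = 0 := by
  -- the rational Lie algebra `𝔞 ⊆ 𝔰𝔭(V, ψ)` of `q`, with `E = End_Hdg(V)` as commuting family
  set 𝔞 : Submodule ℚ (Module.End ℚ V) := annLie ψ.form eQ (fun a : H.endAlg => (a : Module.End ℚ V)) q
    with h𝔞
  have hΘC : Θ ∈ H.hodgeLieC := H.mem_hodgeLieC_of_forall_piece hΘ
  have hΘ𝔞 : Θ ∈ spanC 𝔞 :=
    mem_spanC_annLie ψ.form eQ _ q hΘq (fun a => commute_baseChange_of_mem_hodgeLieC H hΘC a)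
      fun x y => by rw [formBaseChange_skew_of_mem_hodgeLieC ψ hΘC, neg_add_cancel]
  have hbr : ∀ X ∈ 𝔞, ∀ X' ∈ 𝔞, X * X' - X' * X ∈ 𝔞 := fun X hX X' hX' =>
    commutator_mem_annLie ψ.form eQ _ q hX hX'
  have hskew : ∀ X ∈ 𝔞, ∀ v w, ψ.form (X v) w + ψ.form v (X w) = 0 :=
    fun X hX => ((mem_annLie_iff ψ.form eQ _ q X).1 hX).2.2
  have hY : Y ∈ spanC 𝔞 := SymplecticThetaFourteen.mem_spanC_of_skew H hn heff ψ hE hV 𝔞 hbr hΘ hΘ𝔞 hskew hYskew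
  rw [h𝔞] at hY
  exact wordDerAt_eq_zero_of_mem_spanC_annLie ψ.form eQ _ q hY u

end AnnLie

end HodgeStructure

end Literature.AlgebraicGeometry.Motives
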